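import Summits.QuantumFields.YangMills.Theorems.BalabanUVNodesN15KingModelMasslessScalingBound
import Mathlib.MeasureTheory.Integral.DominatedConvergence

/-!
# BalabanUVNodes ∕ N15 — THE KING-MODEL RUNG (PART Ϻ-y): THE MASSLESS TWO-POINT FUNCTION IN PROPER TIME — `lim_{m↓0}S₂^{ℝ}_m(z) = ∫₀^∞Π_μJ_t(z_μ)dt` by dominated convergence
# (`d + 1 ≥ 3`), the massless free propagator as `lim_{m↓0}C_m(R) = ∫₀^∞k_t(R)dt`, and the TWO-SIDED canonical power law
# `Γ((d−1)∕2)∕(4π^{(d+1)∕2}R₊(z)^{d−1}) ≤ ∫₀^∞Π_μJ_t(z_μ)dt ≤ Γ((d−1)∕2)∕(4π^{(d+1)∕2}R₋(z)^{d−1})` (Track A, DAG node N15 = NE2; FAN-OUT v1.1 §N15 s3 «KING-MODEL RUNG»; count-neutral)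

HONEST FRAMING.  Count-neutral (cell `pub-ymgap`, seat `pub-ymgap-dag-n15-e` g35; `--supports stmt-QuantumFields-27366 --as helper` = K3⁸).  King's `A = 0`, `g = 0` model
([King1986] C. King, Commun. Math. Phys. **102** (1986) 649–677).  Part Ϻ-b wrote `S₂^{ℝ}_m(z) = ∫₀^∞e^{−tm²}Π_μJ_t(z_μ)dt`, `J_t(x) = ∫Λ(u)g_t(x−u)du`; part Ϻ-u bounded `Π_μJ_t(z_μ)` by `1` on
`(0,1]` and by `t^{−3∕2}` on `(1,∞)` when `d ≥ 2`.  So the massless integrand `Π_μJ_t(z_μ)` is integrable on `(0,∞)` and DOMINATED CONVERGENCE as `m² ↓ 0` gives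
★★ `S₂^{ℝ}_m(z) → S₂^{0}(z) := ∫₀^∞Π_μJ_t(z_μ)dt` — the massless block two-point function in proper-time ∕ position-space form (the `m ↓ 0` limit of part Ϻ-x by another route);
likewise ★ `C_m(R) → ∫₀^∞k_t(R)dt = Γ((d−1)∕2)∕(4π^{(d+1)∕2}R^{d−1})` (part Ϻ-u's closed form).  Part Ϻ-c's pointwise sandwich `k_t(R₊(z)) ≤ Π_μJ_t(z_μ) ≤ k_t(R₋(z))` integrates to
★★★ the TWO-SIDED CANONICAL SCALING of the massless block field: `Γ((d−1)∕2)∕(4π^{(d+1)∕2}R₊(z)^{d−1}) ≤ S₂^{0}(z)` for EVERY `z`, and `S₂^{0}(z) ≤ Γ((d−1)∕2)∕(4π^{(d+1)∕2}R₋(z)^{d−1})`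
for separated blocks — in three dimensions `1∕(4πR₊(z)) ≤ S₂^{0}(z) ≤ 1∕(4πR₋(z))`: the massless block field IS Coulombic, up to the block-size ambiguity `R₋ ≤ |z| ≤ R₊`.
NOT Bałaban's objects; NOT a node discharge; nothing continuum-Yang–Mills ∕ `ℝ⁴` ∕ OS ∕ Clay.  0 `sorry`, 0 def; standard axioms.

WHAT THIS FILE PROVES (kernel).  §1 `aestronglyMeasurable_prod_tentAvg`, ★ `integrableOn_prod_tentAvg` (`d ≥ 2`), `integral_prod_tentAvg_le_three`.  §2 ★★ **`tendsto_kingS2Inf_integral_prod_tentAvg`**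
(`S₂^{ℝ}_m(z) → ∫₀^∞Π_μJ_t(z_μ)dt` as `m² ↓ 0`), ★ `tendsto_freePropRadial_nhdsGT_zero`.  §3 ★★ `integral_heatRadial_le_integral_prod_tentAvg`, ★★ `integral_prod_tentAvg_le_integral_heatRadial`,
★★★ **`massless_lower_bound`** ∕ **`massless_upper_bound`** (closed forms), ★★ `massless_coulomb_sandwich` (`d + 1 = 3`).

HONEST SCOPE.  King's free `K = |Ω| = ∞` block field, `d + 1 ≥ 3`; the identification with part Ϻ-x's `kingS2Inf0` (a `sup`) is by uniqueness of limits and is filed once that part lands.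
N15 untouched; counts unmoved.  Locators (use): [King1986] Thm 2.1 (2.22) p.654, (4.5)–(4.8) pp.670–671.
-/

noncomputable section

open scoped BigOperators Topology
open Filter MeasureTheory Set

namespace Summit.QuantumFields.YangMills.BalabanUVNodes.N15KingModelRung.ProperTime

open Summit.QuantumFields.YangMills.BalabanUVNodes.N15KingModelRung.OptimalDecay
open Literature.Analysis.Fourier (tent tent_nonneg)

variable {d : ℕ}

/-! ## §1 The massless proper-time integrand is integrable in `d + 1 ≥ 3` -/

/-- `t ↦ Π_μJ_t(z_μ)` is a.e.-strongly measurable on `(0,∞)` (it is `e^{t}` times part Ϻ-c's integrable tent form at `m² = 1`). [folklore] -/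
theorem aestronglyMeasurable_prod_tentAvg (z : Fin (d + 1) → ℤ) :
    AEStronglyMeasurable (fun t : ℝ => ∏ μ, ∫ u : ℝ, tent 1 u * gaussLine t ((z μ : ℝ) - u)) (volume.restrict (Ioi (0 : ℝ))) := by
  have h := (integrableOn_tentForm (d := d) one_pos z).aestronglyMeasurable
  have h2 : AEStronglyMeasurable (fun t : ℝ => Real.exp (t * 1) * (Real.exp (-(t * 1)) * ∏ μ, ∫ u : ℝ, tent 1 u * gaussLine t ((z μ : ℝ) - u)))
      (volume.restrict (Ioi (0 : ℝ))) := ((by fun_prop : Continuous fun t : ℝ => Real.exp (t * 1)).aestronglyMeasurable).mul h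
  refine h2.congr (Filter.Eventually.of_forall fun t => ?_)
  simp only
  rw [← mul_assoc, ← Real.exp_add, add_neg_cancel, Real.exp_zero, one_mul]

/-- `Π_μJ_t(z_μ) ≥ 0`. [folklore] -/
theorem prod_tentAvg_nonneg (t : ℝ) (z : Fin (d + 1) → ℤ) : 0 ≤ ∏ μ, ∫ u : ℝ, tent 1 u * gaussLine t ((z μ : ℝ) - u) :=
  Finset.prod_nonneg fun _ _ => tentAvg_nonneg _ _

/-- ★ **The massless proper-time integrand `Π_μJ_t(z_μ)` is integrable on `(0,∞)`** for `d ≥ 2` (`≤ 1` on `(0,1]`, `≤ t^{−3∕2}` on `(1,∞)`). [folklore] -/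
theorem integrableOn_prod_tentAvg (hd : 2 ≤ d) (z : Fin (d + 1) → ℤ) :
    IntegrableOn (fun t : ℝ => ∏ μ, ∫ u : ℝ, tent 1 u * gaussLine t ((z μ : ℝ) - u)) (Ioi (0 : ℝ)) := by
  have hmeas := aestronglyMeasurable_prod_tentAvg (d := d) z
  have h1 : IntegrableOn (fun t : ℝ => ∏ μ, ∫ u : ℝ, tent 1 u * gaussLine t ((z μ : ℝ) - u)) (Ioc (0 : ℝ) 1) := by
    have hc : IntegrableOn (fun _ : ℝ => (1 : ℝ)) (Ioc (0 : ℝ) 1) := integrableOn_const (by simp)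
    refine hc.mono' (hmeas.mono_measure (Measure.restrict_mono Ioc_subset_Ioi_self le_rfl)) ?_
    filter_upwards [ae_restrict_mem measurableSet_Ioc] with t ht
    rw [Real.norm_eq_abs, abs_of_nonneg (prod_tentAvg_nonneg t z)]
    exact prod_tentAvg_le_one ht.1 z
  have h2 : IntegrableOn (fun t : ℝ => ∏ μ, ∫ u : ℝ, tent 1 u * gaussLine t ((z μ : ℝ) - u)) (Ioi (1 : ℝ)) := by
    refine (integrableOn_Ioi_rpow_of_lt (by norm_num : (-(3 / 2 : ℝ)) < -1) one_pos).mono'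
      (hmeas.mono_measure (Measure.restrict_mono (Ioi_subset_Ioi zero_le_one) le_rfl)) ?_
    filter_upwards [ae_restrict_mem measurableSet_Ioi] with t ht
    have ht1 : 1 < t := ht
    rw [Real.norm_eq_abs, abs_of_nonneg (prod_tentAvg_nonneg t z)]
    exact (prod_tentAvg_le_inv_sqrt_pow (by linarith) z).trans (inv_sqrt_pow_le_rpow_of_one_lt hd ht1)
  rw [← Ioc_union_Ioi_eq_Ioi zero_le_one]
  exact h1.union h2

/-- `∫₀^∞Π_μJ_t(z_μ)dt ≤ 3` (`d ≥ 2`). [folklore] -/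
theorem integral_prod_tentAvg_le_three (hd : 2 ≤ d) (z : Fin (d + 1) → ℤ) : ∫ t in Ioi (0 : ℝ), ∏ μ, ∫ u : ℝ, tent 1 u * gaussLine t ((z μ : ℝ) - u) ≤ 3 := by
  have hfi := integrableOn_prod_tentAvg hd z
  rw [← Ioc_union_Ioi_eq_Ioi zero_le_one, setIntegral_union Ioc_disjoint_Ioi_same measurableSet_Ioi (hfi.mono_set Ioc_subset_Ioi_self)
    (hfi.mono_set (Ioi_subset_Ioi zero_le_one))]
  have h1 : ∫ t in Ioc (0 : ℝ) 1, ∏ μ, ∫ u : ℝ, tent 1 u * gaussLine t ((z μ : ℝ) - u) ≤ 1 := by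
    calc ∫ t in Ioc (0 : ℝ) 1, ∏ μ, ∫ u : ℝ, tent 1 u * gaussLine t ((z μ : ℝ) - u) ≤ ∫ _ in Ioc (0 : ℝ) 1, (1 : ℝ) :=
          setIntegral_mono_on (hfi.mono_set Ioc_subset_Ioi_self) (integrableOn_const (by simp)) measurableSet_Ioc fun t ht => prod_tentAvg_le_one ht.1 z
      _ = 1 := by rw [setIntegral_const, Real.volume_real_Ioc_of_le zero_le_one]; simp
  have h2 : ∫ t in Ioi (1 : ℝ), ∏ μ, ∫ u : ℝ, tent 1 u * gaussLine t ((z μ : ℝ) - u) ≤ 2 := by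
    calc ∫ t in Ioi (1 : ℝ), ∏ μ, ∫ u : ℝ, tent 1 u * gaussLine t ((z μ : ℝ) - u) ≤ ∫ t in Ioi (1 : ℝ), t ^ (-(3 / 2 : ℝ)) :=
          setIntegral_mono_on (hfi.mono_set (Ioi_subset_Ioi zero_le_one)) (integrableOn_Ioi_rpow_of_lt (by norm_num) one_pos) measurableSet_Ioi
            fun t ht => (prod_tentAvg_le_inv_sqrt_pow (by simp only [mem_Ioi] at ht; linarith) z).trans (inv_sqrt_pow_le_rpow_of_one_lt hd ht)
      _ = 2 := by rw [integral_Ioi_rpow_of_lt (by norm_num) one_pos, Real.one_rpow]; norm_num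
  linarith

/-! ## §2 Dominated convergence as `m² ↓ 0` -/

/-- ★★ **THE MASSLESS LIMIT IN PROPER TIME**: `S₂^{ℝ}_m(z) → ∫₀^∞Π_μJ_t(z_μ)dt` as `m² ↓ 0` (`d ≥ 2`; dominated convergence with the integrable majorant `Π_μJ_t(z_μ)`).
[cite: King1986, Thm 2.1 (2.22) p.654, (4.5) p.670] -/
theorem tendsto_kingS2Inf_integral_prod_tentAvg (hd : 2 ≤ d) (z : Fin (d + 1) → ℤ) :
    Tendsto (fun m2 : ℝ => kingS2Inf m2 z) (𝓝[>] 0) (𝓝 (∫ t in Ioi (0 : ℝ), ∏ μ, ∫ u : ℝ, tent 1 u * gaussLine t ((z μ : ℝ) - u))) := by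
  have hev : (fun m2 : ℝ => ∫ t in Ioi (0 : ℝ), Real.exp (-(t * m2)) * ∏ μ, ∫ u : ℝ, tent 1 u * gaussLine t ((z μ : ℝ) - u)) =ᶠ[𝓝[>] 0]
      fun m2 : ℝ => kingS2Inf m2 z :=
    eventually_nhdsWithin_of_forall fun m2 hm2 => (kingS2Inf_eq_integral_tent_gaussLine hm2 z).symm
  refine Tendsto.congr' hev ?_
  have hP := integrableOn_prod_tentAvg hd z
  refine tendsto_integral_filter_of_dominated_convergence (fun t => ∏ μ, ∫ u : ℝ, tent 1 u * gaussLine t ((z μ : ℝ) - u)) ?_ ?_ hP ?_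
  · exact eventually_nhdsWithin_of_forall fun m2 hm2 => (integrableOn_tentForm hm2 z).aestronglyMeasurable
  · refine eventually_nhdsWithin_of_forall fun m2 (hm2 : 0 < m2) => ?_
    filter_upwards [ae_restrict_mem measurableSet_Ioi] with t ht
    have ht : 0 < t := ht
    rw [Real.norm_eq_abs, abs_of_nonneg (mul_nonneg (Real.exp_nonneg _) (prod_tentAvg_nonneg t z))]
    calc Real.exp (-(t * m2)) * ∏ μ, ∫ u : ℝ, tent 1 u * gaussLine t ((z μ : ℝ) - u) ≤ 1 * ∏ μ, ∫ u : ℝ, tent 1 u * gaussLine t ((z μ : ℝ) - u) :=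
          mul_le_mul_of_nonneg_right (Real.exp_le_one_iff.mpr (by nlinarith [mul_pos ht hm2])) (prod_tentAvg_nonneg t z)
      _ = _ := one_mul _
  · refine Filter.Eventually.of_forall fun t => ?_
    have hc : Tendsto (fun m2 : ℝ => Real.exp (-(t * m2)) * ∏ μ, ∫ u : ℝ, tent 1 u * gaussLine t ((z μ : ℝ) - u)) (𝓝 0)
        (𝓝 (Real.exp (-(t * 0)) * ∏ μ, ∫ u : ℝ, tent 1 u * gaussLine t ((z μ : ℝ) - u))) :=
      ((by fun_prop : Continuous fun m2 : ℝ => Real.exp (-(t * m2)) * ∏ μ, ∫ u : ℝ, tent 1 u * gaussLine t ((z μ : ℝ) - u)).tendsto 0)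
    rw [mul_zero, neg_zero, Real.exp_zero, one_mul] at hc
    exact tendsto_nhdsWithin_of_tendsto_nhds hc

/-- ★ **The massless free propagator as a limit**: `C_m(R) → ∫₀^∞k_t(R)dt` as `m² ↓ 0` (`d ≥ 2`, `R > 0`). [folklore] -/
theorem tendsto_freePropRadial_nhdsGT_zero (hd : 2 ≤ d) {R : ℝ} (hR : 0 < R) :
    Tendsto (fun m2 : ℝ => freePropRadial d m2 R) (𝓝[>] 0) (𝓝 (∫ t in Ioi (0 : ℝ), heatRadial d t R)) := by
  unfold freePropRadial
  refine tendsto_integral_filter_of_dominated_convergence (fun t => heatRadial d t R) ?_ ?_ (integrableOn_heatRadial hd hR) ?_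
  · exact Filter.Eventually.of_forall fun m2 => (((by fun_prop : Measurable fun t : ℝ => Real.exp (-(t * m2))).mul (measurable_heatRadial R))).aestronglyMeasurable
  · refine eventually_nhdsWithin_of_forall fun m2 (hm2 : 0 < m2) => ?_
    filter_upwards [ae_restrict_mem measurableSet_Ioi] with t ht
    have ht : 0 < t := ht
    rw [Real.norm_eq_abs, abs_of_nonneg (mul_nonneg (Real.exp_nonneg _) (heatRadial_nonneg _ _))]
    calc Real.exp (-(t * m2)) * heatRadial d t R ≤ 1 * heatRadial d t R :=
          mul_le_mul_of_nonneg_right (Real.exp_le_one_iff.mpr (by nlinarith [mul_pos ht hm2])) (heatRadial_nonneg _ _)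
      _ = _ := one_mul _
  · refine Filter.Eventually.of_forall fun t => ?_
    have hc : Tendsto (fun m2 : ℝ => Real.exp (-(t * m2)) * heatRadial d t R) (𝓝 0) (𝓝 (Real.exp (-(t * 0)) * heatRadial d t R)) :=
      ((by fun_prop : Continuous fun m2 : ℝ => Real.exp (-(t * m2)) * heatRadial d t R).tendsto 0)
    rw [mul_zero, neg_zero, Real.exp_zero, one_mul] at hc
    exact tendsto_nhdsWithin_of_tendsto_nhds hc

/-! ## §3 The two-sided canonical power law of the massless two-point function -/

/-- ★★ Lower comparison at zero mass: `∫₀^∞k_t(R₊(z))dt ≤ ∫₀^∞Π_μJ_t(z_μ)dt` for EVERY `z` (`d ≥ 2`). [cite: King1986, Thm 2.1 (2.22) p.654, (4.5) p.670] -/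
theorem integral_heatRadial_le_integral_prod_tentAvg (hd : 2 ≤ d) (z : Fin (d + 1) → ℤ) :
    ∫ t in Ioi (0 : ℝ), heatRadial d t (blockSpan z) ≤ ∫ t in Ioi (0 : ℝ), ∏ μ, ∫ u : ℝ, tent 1 u * gaussLine t ((z μ : ℝ) - u) :=
  setIntegral_mono_on (integrableOn_heatRadial hd (blockSpan_pos z)) (integrableOn_prod_tentAvg hd z) measurableSet_Ioi fun _ ht => heatRadial_le_prod_tentAvg ht z

/-- ★★ Upper comparison at zero mass: `∫₀^∞Π_μJ_t(z_μ)dt ≤ ∫₀^∞k_t(R₋(z))dt` for separated blocks (`R₋(z) > 0`, `d ≥ 2`). [cite: King1986, Thm 2.1 (2.22) p.654, (4.5) p.670] -/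
theorem integral_prod_tentAvg_le_integral_heatRadial (hd : 2 ≤ d) {z : Fin (d + 1) → ℤ} (hgap : 0 < blockGap z) :
    ∫ t in Ioi (0 : ℝ), ∏ μ, ∫ u : ℝ, tent 1 u * gaussLine t ((z μ : ℝ) - u) ≤ ∫ t in Ioi (0 : ℝ), heatRadial d t (blockGap z) :=
  setIntegral_mono_on (integrableOn_prod_tentAvg hd z) (integrableOn_heatRadial hd hgap) measurableSet_Ioi fun _ ht => prod_tentAvg_le_heatRadial ht z

/-- ★★★ **THE MASSLESS LOWER BOUND, EVERY `z`**: `Γ((d−1)∕2)∕(4π^{(d+1)∕2}R₊(z)^{d−1}) ≤ ∫₀^∞Π_μJ_t(z_μ)dt` — the massless block two-point function decays NO FASTER than the canonical power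
at the largest inter-block distance. [cite: King1986, Thm 2.1 (2.22) p.654, (4.5) p.670] -/
theorem massless_lower_bound (hd : 2 ≤ d) (z : Fin (d + 1) → ℤ) :
    Real.Gamma (((d : ℝ) - 1) / 2) / (4 * Real.pi ^ (((d : ℝ) + 1) / 2) * blockSpan z ^ (d - 1)) ≤ ∫ t in Ioi (0 : ℝ), ∏ μ, ∫ u : ℝ, tent 1 u * gaussLine t ((z μ : ℝ) - u) := by
  rw [← integral_heatRadial hd (blockSpan_pos z)]
  exact integral_heatRadial_le_integral_prod_tentAvg hd z

/-- ★★★ **THE MASSLESS UPPER BOUND, SEPARATED BLOCKS**: `∫₀^∞Π_μJ_t(z_μ)dt ≤ Γ((d−1)∕2)∕(4π^{(d+1)∕2}R₋(z)^{d−1})`. [cite: King1986, Thm 2.1 (2.22) p.654, (4.5) p.670] -/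
theorem massless_upper_bound (hd : 2 ≤ d) {z : Fin (d + 1) → ℤ} (hgap : 0 < blockGap z) :
    ∫ t in Ioi (0 : ℝ), ∏ μ, ∫ u : ℝ, tent 1 u * gaussLine t ((z μ : ℝ) - u) ≤ Real.Gamma (((d : ℝ) - 1) / 2) / (4 * Real.pi ^ (((d : ℝ) + 1) / 2) * blockGap z ^ (d - 1)) := by
  rw [← integral_heatRadial hd hgap]
  exact integral_prod_tentAvg_le_integral_heatRadial hd hgap

/-- ★★ **THREE DIMENSIONS: THE COULOMB SANDWICH** — `1∕(4πR₊(z)) ≤ ∫₀^∞Π_μJ_t(z_μ)dt ≤ 1∕(4πR₋(z))` (`d + 1 = 3`, separated blocks for the upper half). [cite: King1986, Thm 2.1 (2.22) p.654] -/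
theorem massless_coulomb_sandwich {z : Fin (2 + 1) → ℤ} (hgap : 0 < blockGap z) :
    (4 * Real.pi * blockSpan z)⁻¹ ≤ ∫ t in Ioi (0 : ℝ), ∏ μ, ∫ u : ℝ, tent 1 u * gaussLine t ((z μ : ℝ) - u)
      ∧ ∫ t in Ioi (0 : ℝ), ∏ μ, ∫ u : ℝ, tent 1 u * gaussLine t ((z μ : ℝ) - u) ≤ (4 * Real.pi * blockGap z)⁻¹ := by
  have hπ := Real.pi_pos
  have e1 : Real.Gamma ((((2 : ℕ) : ℝ) - 1) / 2) = Real.sqrt Real.pi := by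
    rw [← Real.Gamma_one_half_eq]; norm_num
  have e2 : Real.pi ^ ((((2 : ℕ) : ℝ) + 1) / 2) = Real.pi * Real.sqrt Real.pi := by
    rw [show ((((2 : ℕ) : ℝ) + 1) / 2) = 1 + 1 / 2 by norm_num, Real.rpow_add hπ, Real.rpow_one, Real.sqrt_eq_rpow]
  have hs : 0 < Real.sqrt Real.pi := Real.sqrt_pos.mpr hπ
  have key : ∀ {R : ℝ}, 0 < R → Real.sqrt Real.pi / (4 * (Real.pi * Real.sqrt Real.pi) * R) = (4 * Real.pi * R)⁻¹ := fun hR => by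
    field_simp
  have hl := massless_lower_bound (d := 2) le_rfl z
  have hu := massless_upper_bound (d := 2) le_rfl hgap
  rw [e1, e2, show (2 - 1 : ℕ) = 1 from rfl, pow_one] at hl hu
  rw [key (blockSpan_pos z)] at hl
  rw [key hgap] at hu
  exact ⟨hl, hu⟩

end Summit.QuantumFields.YangMills.BalabanUVNodes.N15KingModelRung.ProperTime
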